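import Literature.NumberTheory.EllipticCurves.Greenberg1999.ControlLocalKernelsLayerGoodInputsProofs
import Literature.NumberTheory.EllipticCurves.Greenberg1999.LocalH1DivisibleCyclotomicProofs
import Literature.NumberTheory.EllipticCurves.GoodReductionUnramifiedProofs
import Literature.NumberTheory.EllipticCurves.GreenbergSelmer
import Literature.NumberTheory.EllipticCurves.SelmerCorankAssembly
import Literature.NumberTheory.EllipticCurves.IwasawaCoinvariantsRankProofs
import HarnessLib

/-!
# `E(K_{∞,w})[p^∞]` is `p`-divisible at a good place `w ∤ p` of the CYCLOTOMIC `ℤ_p`-extension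
# (Greenberg, LNM 1716, §3, proof of Lemma 3.3: "`B_v` is divisible"; proved, no named fact)

`Proofs` file (theorems only) in topic `NumberTheory/EllipticCurves`; second brick of the discharge
of `LimSujatha2018.prop32_fineSelmerDual_moduleFinite_iff_of_torsionIso` (`FineSelmerCongruentCurves`).
In Lim–Sujatha's proof of Prop. 3.2 (J. Number Theory 187 (2018) §3) the comparison of
`R(A[π]/F^cyc)` with `R(A/F^cyc)[π]` is a local computation at the finitely many places of `F^cyc`
above `S`; in the tree's currency (`GreenbergSelmer.fineSelmerInfty`: classes locally trivial at ALL
places of `K_∞`) the places of good reduction `w ∤ p` have to be shown to contribute NOTHING, i.e.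
the local kernel `ker (H¹(K_{∞,w}, E[p]) → H¹(K_{∞,w}, E[p^∞])) = E(K_{∞,w})[p^∞]/p` vanishes:
**`B_w = E(K_{∞,w})[p^∞]` is `p`-divisible** — the statement Greenberg uses in the proof of
Lemma 3.3 (LNM 1716, p. 87: "Now assume that `E` has good reduction at `v` … `B_v` is divisible").

* `ZpExtension.IsCyclotomic.exists_fixed_and_nsmul_eq_of_hasGoodReductionAt`: for a number field `K`,
  an elliptic curve `E = W/K`, a prime `p`, the CYCLOTOMIC `ℤ_p`-extension `κ` (`H = Gal(K̄/K_∞)`), a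
  finite place `v ∤ p` of good reduction and `D_v ≤ Γ_K` the decomposition group of the chosen prime
  above `v`: every `a ∈ E[p^∞]` fixed by `H ⊓ D_v` is `p • b` for some `b ∈ E[p^∞]` fixed by `H ⊓ D_v`.

Proof (Greenberg's "`F_{∞,η}` contains the unramified `ℤ_p`-extension of `F_v`", made finite):
the local group `H_{v,∞} = (Γ_{K_v} → Γ_K)⁻¹(H)` is the intersection of the open layer groups
`H_{v,m}`, each topologically generated by the inertia group `I` and a power `F^M` of a local
Frobenius (`exists_frobenius_pow_generate_localSubgroup`); `I` fixes `E[p^k]` (good reduction,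
`v ∤ p`, *AEC* VII.4.1); by compactness some `H_{v,m₀}` fixes `a`; the `F`-orbit of a `p`-th root `b₀`
of `a` is finite, of length `N = p^e N₀`; since `κ(F) ≠ 1` (no finite place splits completely in the
cyclotomic tower) the exponents `M` with `F^M ∈ H_{v,m}` are divisible by `p^e` for `m` large, so
`g = F^M` moves `b₀` through an orbit of length dividing `N₀`, prime to `p`; the average
`x • ∑_{j<N₀} g^j b₀` (`x N₀ ≡ 1 mod p^k`) is a `p`-th root of `a` fixed by `I` and `g`, hence by
`H_{v,m} ⊇ H_{v,∞}`. HONEST FRAMING: theorems only; nothing about BSD is claimed.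

References: [GreenbergLNM1716] R. Greenberg, LNM 1716 (1999), §3 Lemma 3.3 (proof, p. 87), §1
("`Gal((F_∞)_η/F_v) ≅ ℤ_p`"); [LimSujatha2018] §3 (proof of Prop. 3.2); [SilvermanAEC2009] VII.4.1;
[Washington1997] §13.1; [NeukirchANT1999] II (9.6), (9.9)–(9.11).
-/

set_option autoImplicit false

noncomputable section

open scoped Classical AddSubgroup

universe u

namespace Literature.NumberTheory.EllipticCurves.ZpExtension.IsCyclotomic

open NumberField IsDedekindDomain Field Filter Topology
open Literature.NumberTheory.EllipticCurves Literature.NumberTheory.EllipticCurves.GreenbergSelmer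
  Literature.NumberTheory.GaloisRepresentations WeierstrassCurve
  Literature.NumberTheory.EllipticCurves.Greenberg1999 IsDedekindDomain.HeightOneSpectrum

/-! ## §1 Arithmetic in `ℤ_p` -/

section Padic

variable {p : ℕ} [Fact p.Prime]

/-- An element of `ℤ_p` divisible by every power of `p` is `0`. [folklore] -/
private theorem eq_zero_of_forall_pow_dvd {x : ℤ_[p]} (h : ∀ m : ℕ, (p : ℤ_[p]) ^ m ∣ x) : x = 0 := by
  by_contra hx
  have h1 : x ∈ Ideal.span {(p : ℤ_[p]) ^ (x.valuation + 1)} := Ideal.mem_span_singleton.mpr (h _)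
  have h2 := (PadicInt.norm_le_pow_iff_mem_span_pow x (x.valuation + 1)).mpr h1
  have h3 := (PadicInt.norm_le_pow_iff_le_valuation x hx (x.valuation + 1)).mp h2
  omega

/-- If `M • u ∈ p^m ℤ_p` with `u ≠ 0`, then `p^(m - v(u)) ∣ M`; in the form used below: for every `e`
there is `m₁` such that `p^m ∣ M • u` with `m₁ ≤ m` forces `p^e ∣ M`. [folklore] -/
private theorem exists_forall_pow_dvd_of_dvd_nsmul {u : ℤ_[p]} (hu : u ≠ 0) (e : ℕ) :
    ∃ m₁ : ℕ, ∀ m : ℕ, m₁ ≤ m → ∀ M : ℕ, (p : ℤ_[p]) ^ m ∣ M • u → p ^ e ∣ M := by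
  refine ⟨e + u.valuation, fun m hm M hM ↦ ?_⟩
  have hp : (p : ℤ_[p]) ≠ 0 := by exact_mod_cast (Fact.out : p.Prime).ne_zero
  -- `M • u = M * w * p^v`, `w` a unit
  rw [nsmul_eq_mul, PadicInt.unitCoeff_spec hu] at hM
  have h1 : (p : ℤ_[p]) ^ (e + u.valuation) ∣ (M : ℤ_[p]) * (PadicInt.unitCoeff hu : ℤ_[p]) *
      (p : ℤ_[p]) ^ u.valuation := by
    rw [mul_assoc]
    exact (pow_dvd_pow _ hm).trans hM
  rw [pow_add] at h1
  have h2 : (p : ℤ_[p]) ^ e ∣ (M : ℤ_[p]) * (PadicInt.unitCoeff hu : ℤ_[p]) :=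
    (mul_dvd_mul_iff_right (pow_ne_zero _ hp)).mp h1
  have h3 : (p : ℤ_[p]) ^ e ∣ (M : ℤ_[p]) :=
    ((PadicInt.unitCoeff hu).isUnit.dvd_mul_right).mp h2
  -- read it in `ℤ/p^e`
  have h4 : (M : ℤ_[p]) ∈ RingHom.ker (PadicInt.toZModPow e : ℤ_[p] →+* ZMod (p ^ e)) := by
    rw [PadicInt.ker_toZModPow, Ideal.mem_span_singleton]
    exact h3
  rw [RingHom.mem_ker, map_natCast] at h4
  exact (ZMod.natCast_eq_zero_iff M (p ^ e)).mp h4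

end Padic

/-! ## §2 The local group of the cyclotomic tower at `v ∤ p` -/

section Local

variable {K : Type} [Field K] [NumberField K] {p : ℕ} [Fact p.Prime] {κ : ZpExtension K p}
  {v : HeightOneSpectrum (𝓞 K)}

/-- An element of `Γ_{K_v}` lying in every local layer group `H_{v,m}` lies in `H_{v,∞}`
(`κ` of it is divisible by every `p^m`). [folklore] -/
private theorem mem_localSubgroup_ker_of_forall_mem_layer
    {σ : absoluteGaloisGroup (v.adicCompletion K)}
    (h : ∀ m : ℕ, σ ∈ localSubgroup (κ.layerSubgroup m) (v.adicCompletion K)) :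
    σ ∈ localSubgroup κ.kerSubgroup (v.adicCompletion K) := by
  rw [mem_localSubgroup_iff, ZpExtension.mem_kerSubgroup]
  have h' : ∀ m : ℕ, (p : ℤ_[p]) ^ m ∣ (κ (resGal (K := K) (v.adicCompletion K) σ)).toAdd :=
    fun m ↦ ZpExtension.mem_layerSubgroup.mp ((mem_localSubgroup_iff _ _ σ).mp (h m))
  have := eq_zero_of_forall_pow_dvd h'
  exact Multiplicative.toAdd.injective this

/-- **No Frobenius of `K_v` lies in `Gal(K̄_v/K_{∞,w})` for the cyclotomic tower** (`v ∤ p`): for a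
local arithmetic Frobenius `F`, `κ(F|_{K̄}) ≠ 1`. Otherwise every power of `F` lies in every
`H_{v,m}`, which is topologically generated by the inertia group and a power of `F`
(`exists_frobenius_pow_generate_localSubgroup`), so `Γ_{K_v} = H_{v,0} ≤ H_{v,m}` for all `m` and
`κ` would vanish on `Γ_{K_v}` — contradicting `exists_apply_resGal_ne_one_of_isCyclotomic`
("`Gal((F_∞)_η/F_v) ≅ ℤ_p`", Greenberg §1). [cite: GreenbergLNM1716, §1 ("Gal((F_∞)_η/F_v) ≅ ℤ_p" for every non-archimedean η)] [cite: Washington1997, §13.1] -/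
theorem apply_resGal_frobenius_ne_one (hκ : κ.IsCyclotomic) (hpv : (p : 𝓞 K) ∉ v.asIdeal)
    {𝔐 : Ideal (localAbsIntegers v)} (h𝔐 : 𝔐 ∈ v.localPrimesAbove)
    {F : absoluteGaloisGroup (v.adicCompletion K)}
    (hF : IsArithFrobAt (v.adicCompletionIntegers K) F 𝔐) :
    κ (resGal (K := K) (v.adicCompletion K) F) ≠ 1 := by
  intro h1
  obtain ⟨σ, hσ⟩ := exists_apply_resGal_ne_one_of_isCyclotomic hκ v
  apply hσ
  -- every `H_{v,m}` contains `Γ_{K_v}`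
  have hall : ∀ m : ℕ, σ ∈ localSubgroup (κ.layerSubgroup m) (v.adicCompletion K) := by
    intro m
    obtain ⟨M, -, -, hgen⟩ := exists_frobenius_pow_generate_localSubgroup κ hpv h𝔐 hF 0
    -- `F^M ∈ H_{v,m}` since `κ(F) = 1`
    have hFM : F ^ M ∈ localSubgroup (κ.layerSubgroup m) (v.adicCompletion K) := by
      refine WeierstrassCurve.localSubgroup_ker_le_layer κ (v.adicCompletion K) m ?_
      rw [mem_localSubgroup_iff, ZpExtension.mem_kerSubgroup, map_pow, map_pow, h1, one_pow]
    have hI : 𝔐.inertia (absoluteGaloisGroup (v.adicCompletion K)) ≤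
        localSubgroup (κ.layerSubgroup m) (v.adicCompletion K) := fun τ hτ ↦
      WeierstrassCurve.localSubgroup_ker_le_layer κ (v.adicCompletion K) m
        ((mem_localSubgroup_iff _ _ τ).mpr
          (ZpExtension.inertia_le_kerSubgroup_holds K p κ hpv (primeBelow_mem_primesAbove h𝔐)
            (v.resGalOfEmb_mem_inertia_primeBelow (closureEmb (K := K) (v.adicCompletion K)) 𝔐 hτ)))
    have h0 := hgen _ (isOpen_localSubgroup_layerSubgroup (v.adicCompletion K) κ m) hI hFM
    have hσ0 : σ ∈ localSubgroup (κ.layerSubgroup 0) (v.adicCompletion K) := by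
      rw [mem_localSubgroup_iff, ZpExtension.layerSubgroup_zero]; exact Subgroup.mem_top _
    exact h0 hσ0
  have := mem_localSubgroup_ker_of_forall_mem_layer hall
  rwa [mem_localSubgroup_iff, ZpExtension.mem_kerSubgroup] at this

/-- For `m` large, `F^M ∈ H_{v,m}` forces `p^e ∣ M` (`κ(F^M) = M • κ(F)` with `κ(F) ≠ 0`).
[cite: GreenbergLNM1716, §1] -/
theorem exists_forall_pow_dvd_of_pow_mem_localSubgroup (hκ : κ.IsCyclotomic)
    (hpv : (p : 𝓞 K) ∉ v.asIdeal) {𝔐 : Ideal (localAbsIntegers v)} (h𝔐 : 𝔐 ∈ v.localPrimesAbove)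
    {F : absoluteGaloisGroup (v.adicCompletion K)}
    (hF : IsArithFrobAt (v.adicCompletionIntegers K) F 𝔐) (e : ℕ) :
    ∃ m₁ : ℕ, ∀ m : ℕ, m₁ ≤ m → ∀ M : ℕ,
      F ^ M ∈ localSubgroup (κ.layerSubgroup m) (v.adicCompletion K) → p ^ e ∣ M := by
  have hu : (κ (resGal (K := K) (v.adicCompletion K) F)).toAdd ≠ 0 := by
    intro h0
    exact apply_resGal_frobenius_ne_one hκ hpv h𝔐 hF (Multiplicative.toAdd.injective h0)
  obtain ⟨m₁, hm₁⟩ := exists_forall_pow_dvd_of_dvd_nsmul hu e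
  refine ⟨m₁, fun m hm M hM ↦ hm₁ m hm M ?_⟩
  rw [mem_localSubgroup_iff, ZpExtension.mem_layerSubgroup, map_pow, map_pow, toAdd_pow] at hM
  exact hM

end Local

/-! ## §3 Divisibility of `E(K_{∞,w})[p^∞]` at a good place `w ∤ p` -/

section Divisible

variable {K : Type} [Field K] [NumberField K] (W : WeierstrassCurve K) [W.IsElliptic]
  {p : ℕ} [Fact p.Prime] {κ : ZpExtension K p}

/-- **`E(K_{∞,w})[p^∞]` is `p`-divisible at a place `w ∤ p` of good reduction of the cyclotomic
`ℤ_p`-extension** (Greenberg, LNM 1716, proof of Lemma 3.3: "`B_v` is divisible"): every point of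
`E[p^∞]` fixed by `Gal(K̄/K_∞) ⊓ D_v` is `p` times such a point. See the module docstring for the
proof. [cite: GreenbergLNM1716, §3 Lemma 3.3 (proof, p. 87: "B_v is divisible")] [cite: LimSujatha2018, §3 (proof of Prop. 3.2, the local terms)] -/
theorem exists_fixed_and_nsmul_eq_of_hasGoodReductionAt (hκ : κ.IsCyclotomic)
    {v : HeightOneSpectrum (𝓞 K)} (hpv : (p : 𝓞 K) ∉ v.asIdeal) (hv : W.HasGoodReductionAt v)
    {a : W.geomPrimaryTorsion p} (ha : ∀ δ ∈ κ.kerSubgroup ⊓ decomp v, δ • a = a) :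
    ∃ b : W.geomPrimaryTorsion p, (∀ δ ∈ κ.kerSubgroup ⊓ decomp v, δ • b = b) ∧ p • b = a := by
  have hp : p.Prime := Fact.out
  -- notation
  let Kv := v.adicCompletion K
  let G := absoluteGaloisGroup Kv
  let r : G →ₜ* absoluteGaloisGroup K := resGal (K := K) Kv
  let Hm : ℕ → Subgroup G := fun m ↦ localSubgroup (κ.layerSubgroup m) Kv
  have hrD : ∀ σ : G, r σ ∈ decomp v := fun σ ↦ (mem_decomp_iff v _).mpr ⟨σ, rfl⟩
  -- translation `H ⊓ D_v = r(H_{v,∞})`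
  have hHD : ∀ δ ∈ κ.kerSubgroup ⊓ decomp v, ∃ σ : G, σ ∈ localSubgroup κ.kerSubgroup Kv ∧ r σ = δ := by
    intro δ hδ
    obtain ⟨σ, hσ⟩ := (mem_decomp_iff v δ).mp (Subgroup.mem_inf.mp hδ).2
    refine ⟨σ, ?_, hσ⟩
    rw [mem_localSubgroup_iff]
    change r σ ∈ κ.kerSubgroup
    rw [show r σ = δ from hσ]
    exact (Subgroup.mem_inf.mp hδ).1
  -- the torsion order of `a` and a `p`-th root `b₀`
  obtain ⟨k, hk⟩ : ∃ k : ℕ, p ^ k • a = 0 := by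
    obtain ⟨k, hk⟩ := a.2
    exact ⟨k, Subtype.ext (by rw [AddSubgroupClass.coe_nsmul]; exact hk)⟩
  obtain ⟨b₀, hb₀⟩ := W.exists_nsmul_eq_geomPrimaryTorsion p W.zsmul_geomPoints_surjective_holds a
  have hb₀k : p ^ (k + 1) • b₀ = 0 := by rw [pow_succ, mul_smul, hb₀, hk]
  -- the prime `𝔐`, a local Frobenius `F`
  obtain ⟨𝔐, h𝔐⟩ := v.localPrimesAbove_nonempty
  obtain ⟨F, hF⟩ := exists_isArithFrobAt_localAbsIntegers (v := v) h𝔐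
  -- inertia fixes `E[p^(k+1)]`
  have hIfix : ∀ τ ∈ 𝔐.inertia G, ∀ t : W.geomPrimaryTorsion p, p ^ (k + 1) • t = 0 → r τ • t = t := by
    intro τ hτ t ht
    apply Subtype.ext
    rw [primaryComponent.coe_smul]
    have ht' : (p ^ (k + 1) : ℕ) • (t : W.geomPoints) = 0 := by
      have := congrArg (fun z : W.geomPrimaryTorsion p ↦ (z : W.geomPoints)) ht
      simpa only [AddSubmonoidClass.coe_nsmul, ZeroMemClass.coe_zero] using this
    exact W.smul_eq_of_mem_inertia_of_nsmul_eq_zero hv (v.natCast_pow_not_mem hpv (k + 1))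
      (primeBelow_mem_primesAbove h𝔐)
      (v.resGalOfEmb_mem_inertia_primeBelow (closureEmb (K := K) Kv) 𝔐 hτ) ht'
  have hIle : ∀ m : ℕ, 𝔐.inertia G ≤ Hm m := fun m τ hτ ↦
    WeierstrassCurve.localSubgroup_ker_le_layer κ Kv m
      ((mem_localSubgroup_iff _ _ τ).mpr
        (ZpExtension.inertia_le_kerSubgroup_holds K p κ hpv (primeBelow_mem_primesAbove h𝔐)
          (v.resGalOfEmb_mem_inertia_primeBelow (closureEmb (K := K) Kv) 𝔐 hτ)))
  -- (1) compactness: some `H_{v,m₀}` fixes `a`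
  have hcont : ∀ t : W.geomPrimaryTorsion p, Continuous fun σ : G ↦ r σ • t := fun t ↦
    (W.continuous_smul_geomPrimaryTorsion p t).comp r.continuous_toFun
  have hopen : ∀ t : W.geomPrimaryTorsion p, IsOpen {σ : G | r σ • t = t} := fun t ↦
    (isOpen_discrete {t}).preimage (hcont t)
  obtain ⟨m₀, hm₀⟩ : ∃ m₀ : ℕ, ∀ σ ∈ Hm m₀, r σ • a = a := by
    haveI : CompactSpace G := absoluteGaloisGroup_compactSpace Kv
    have hs : IsCompact ({σ : G | r σ • a = a}ᶜ) := (hopen a).isClosed_compl.isCompact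
    have hclosed : ∀ m : ℕ, IsClosed ((Hm m : Subgroup G) : Set G) := fun m ↦
      Subgroup.isClosed_of_isOpen _ (isOpen_localSubgroup_layerSubgroup Kv κ m)
    have hdir : Directed (· ⊇ ·) fun m : ℕ ↦ ((Hm m : Subgroup G) : Set G) := by
      intro i j
      refine ⟨max i j, ?_, ?_⟩
      · exact Subgroup.comap_mono (f := (r : G →* absoluteGaloisGroup K))
          (κ.layerSubgroup_antitone (le_max_left i j))
      · exact Subgroup.comap_mono (f := (r : G →* absoluteGaloisGroup K))
          (κ.layerSubgroup_antitone (le_max_right i j))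
    have hempty : ({σ : G | r σ • a = a}ᶜ ∩ ⋂ m : ℕ, ((Hm m : Subgroup G) : Set G)) = ∅ := by
      ext σ
      simp only [Set.mem_inter_iff, Set.mem_compl_iff, Set.mem_setOf_eq, Set.mem_iInter,
        SetLike.mem_coe, Set.mem_empty_iff_false, iff_false, not_and, not_forall]
      intro hσ
      by_contra hall
      push Not at hall
      apply hσ
      have hmem := mem_localSubgroup_ker_of_forall_mem_layer hall
      exact ha (r σ) (Subgroup.mem_inf.mpr ⟨(mem_localSubgroup_iff _ _ σ).mp hmem, hrD σ⟩)
    obtain ⟨m₀, hm₀⟩ := hs.elim_directed_family_closed _ hclosed hempty hdir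
    refine ⟨m₀, fun σ hσ ↦ ?_⟩
    by_contra hne
    have : σ ∈ ({σ : G | r σ • a = a}ᶜ ∩ ((Hm m₀ : Subgroup G) : Set G)) := ⟨hne, hσ⟩
    rw [hm₀] at this
    exact this
  -- (2) the `F`-orbit of `b₀` is finite: `(r F)^N • b₀ = b₀`, `N = p^e N₀`
  obtain ⟨N, hNpos, hN⟩ : ∃ N : ℕ, 0 < N ∧ (r F) ^ N • b₀ = b₀ := by
    haveI := W.finite_torsionBy_geomPrimaryTorsion p (k + 1)
    let orb : ℕ → (W.geomPrimaryTorsion p)[(p ^ (k + 1) : ℕ)] := fun j ↦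
      ⟨(r F) ^ j • b₀, by
        rw [AddSubgroup.torsionBy.nsmul_iff, smul_comm, hb₀k, smul_zero]⟩
    obtain ⟨i, j, hij, hij'⟩ := Finite.exists_ne_map_eq_of_infinite orb
    rcases Nat.lt_or_gt_of_ne hij with hlt | hlt
    · refine ⟨j - i, Nat.sub_pos_of_lt hlt, ?_⟩
      have e := congrArg (fun z : (W.geomPrimaryTorsion p)[(p ^ (k + 1) : ℕ)] ↦
        ((r F) ^ i)⁻¹ • (z : W.geomPrimaryTorsion p)) hij'
      simp only [orb] at e
      rw [← mul_smul, ← mul_smul, inv_mul_cancel, one_smul, ← zpow_natCast, ← zpow_natCast,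
        ← zpow_neg, ← zpow_add, show -(i : ℤ) + (j : ℤ) = ((j - i : ℕ) : ℤ) by omega,
        zpow_natCast] at e
      exact e.symm
    · refine ⟨i - j, Nat.sub_pos_of_lt hlt, ?_⟩
      have e := congrArg (fun z : (W.geomPrimaryTorsion p)[(p ^ (k + 1) : ℕ)] ↦
        ((r F) ^ j)⁻¹ • (z : W.geomPrimaryTorsion p)) hij'
      simp only [orb] at e
      rw [← mul_smul, ← mul_smul, inv_mul_cancel, one_smul, ← zpow_natCast, ← zpow_natCast,
        ← zpow_neg, ← zpow_add, show -(j : ℤ) + (i : ℤ) = ((i - j : ℕ) : ℤ) by omega,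
        zpow_natCast] at e
      exact e
  set e := N.factorization p with he
  set N₀ := N / p ^ e with hN₀
  have hNe : N = p ^ e * N₀ := (Nat.ordProj_mul_ordCompl_eq_self N p).symm
  have hN₀cop : p.Coprime N₀ := Nat.coprime_ordCompl hp hNpos.ne'
  -- (3) the layer `m` and the generator `g = F^M`, `p^e ∣ M`
  obtain ⟨m₁, hm₁⟩ := exists_forall_pow_dvd_of_pow_mem_localSubgroup hκ hpv h𝔐 hF e
  set m := max m₀ m₁ with hm
  obtain ⟨M, -, hgm, hgen⟩ := exists_frobenius_pow_generate_localSubgroup κ hpv h𝔐 hF m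
  have hpeM : p ^ e ∣ M := hm₁ m (le_max_right _ _) M hgm
  set g : G := F ^ M with hg
  -- `g` fixes `a`, `g^{N₀}` fixes `b₀`
  have hga : r g • a = a :=
    hm₀ g (Subgroup.comap_mono (f := (r : G →* absoluteGaloisGroup K))
      (κ.layerSubgroup_antitone (le_max_left m₀ m₁)) hgm)
  have hgN₀ : (r g) ^ N₀ • b₀ = b₀ := by
    obtain ⟨c, hc⟩ := hpeM
    have : (r g) ^ N₀ = ((r F) ^ N) ^ c := by
      rw [hg, map_pow, ← pow_mul, ← pow_mul, hc, hNe]; ring_nf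
    rw [this]
    -- `((r F)^N)^c` fixes `b₀`
    suffices h : ∀ c : ℕ, ((r F) ^ N) ^ c • b₀ = b₀ from h c
    intro c
    induction c with
    | zero => rw [pow_zero, one_smul]
    | succ c ih => rw [pow_succ, mul_smul, hN, ih]
  -- (4) the average `b″ = ∑_{j<N₀} g^j • b₀`
  set b'' : W.geomPrimaryTorsion p := ∑ j ∈ Finset.range N₀, (r g) ^ j • b₀ with hb''
  have hgb'' : r g • b'' = b'' := by
    rw [hb'', Finset.smul_sum]
    simp_rw [← mul_smul, ← pow_succ']
    have h1 := Finset.sum_range_succ' (fun j ↦ (r g) ^ j • b₀) N₀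
    have h2 := Finset.sum_range_succ (fun j ↦ (r g) ^ j • b₀) N₀
    rw [pow_zero, one_smul] at h1
    rw [hgN₀] at h2
    exact add_right_cancel (h1.symm.trans h2)
  have hpb'' : p • b'' = N₀ • a := by
    rw [hb'', Finset.smul_sum]
    simp_rw [smul_comm p, hb₀]
    have : ∀ j : ℕ, (r g) ^ j • a = a := by
      intro j
      induction j with
      | zero => rw [pow_zero, one_smul]
      | succ j ih => rw [pow_succ, mul_smul, hga, ih]
    simp_rw [this]
    rw [Finset.sum_const, Finset.card_range]
  have hb''k : p ^ (k + 1) • b'' = 0 := by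
    rw [hb'', Finset.smul_sum]
    simp_rw [smul_comm (p ^ (k + 1)), hb₀k, smul_zero, Finset.sum_const_zero]
  -- (5) normalise: `x N₀ ≡ 1 mod p^k`
  obtain ⟨x, hx⟩ : ∃ x : ℕ, (x * N₀) • a = a := by
    by_cases hk1 : p ^ k = 1
    · refine ⟨0, ?_⟩
      rw [zero_mul, zero_smul, ← one_smul ℕ a, ← hk1, hk]
    · have h1 : 1 < p ^ k := lt_of_le_of_ne (Nat.one_le_pow _ _ hp.pos) (Ne.symm hk1)
      obtain ⟨x, -, hx⟩ := Nat.exists_mul_mod_eq_one_of_coprime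
        (Nat.Coprime.pow_right k hN₀cop.symm) h1
      refine ⟨x, ?_⟩
      rw [mul_comm, ← Nat.div_add_mod (N₀ * x) (p ^ k), hx, add_smul, one_smul, mul_comm, mul_smul, hk,
        smul_zero, zero_add]
  set b' : W.geomPrimaryTorsion p := x • b'' with hb'
  refine ⟨b', fun δ hδ ↦ ?_, ?_⟩
  · -- (6) `b'` is fixed by `I` and `g`, hence by `H_{v,m} ⊇ H_{v,∞}`
    let S : Subgroup G := (MulAction.stabilizer (absoluteGaloisGroup K) b').comap
      (r : G →* absoluteGaloisGroup K)
    have hSopen : IsOpen (S : Set G) := hopen b'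
    have hIS : 𝔐.inertia G ≤ S := fun τ hτ ↦ by
      rw [Subgroup.mem_comap, MulAction.mem_stabilizer_iff]
      refine hIfix τ hτ b' ?_
      rw [hb', smul_comm, hb''k, smul_zero]
    have hgS : g ∈ S := by
      rw [Subgroup.mem_comap, MulAction.mem_stabilizer_iff]
      change r g • b' = b'
      rw [hb', smul_comm, hgb'']
    have hle := hgen S hSopen hIS hgS
    obtain ⟨σ, hσ, rfl⟩ := hHD δ hδ
    have hσS : σ ∈ S := hle (WeierstrassCurve.localSubgroup_ker_le_layer κ Kv m hσ)
    rw [Subgroup.mem_comap, MulAction.mem_stabilizer_iff] at hσS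
    exact hσS
  · rw [hb', smul_comm, hpb'', ← mul_smul, hx]

end Divisible

end Literature.NumberTheory.EllipticCurves.ZpExtension.IsCyclotomic

end
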